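import Summits.Ventures.LatticeQCDFlow.Exactness.IMHCommonRandomNumbersMeetingTimeUnboundedWeights
import Summits.Ventures.LatticeQCDFlow.Exactness.IMHCouplingTotalVariationDiagnostic
import HarnessLib

/-!
# The coupled flow-MCMC estimator is exactly unbiased WITHOUT a weight bound:
# `E f(Y_k) + Σ_{n≥0} E[f(X′_{k+n}) − f(Y_{k+n})] = π f` for every start that integrates the weight and every target with `∫ w² dq < ∞`

HONEST FRAMING: exact (Metropolis-corrected) sampling algorithms for lattice gauge theory;
figures of merit are autocorrelation/cost numbers at stated couplings and volumes; no
continuum-physics claim.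

Venture `LatticeQCDFlow` (cell pub-lqcd), topic `Exactness`; FANOUT row 30 (lean-1, GEN-40).  NEW WORK of the cell (standard Borel `Ω`,
`MeasurableEq Ω`; EVERY proposal law — atoms allowed, via this generation's `…AnyCouplingAtoms`); sequel to GEN-36's `Exactness/IMHCoupledUnbiasedEstimator` (`crnLag_hasSum_integral_diff`,
`crnLag_unbiased`: exact unbiasedness of the Glynn–Rhee ∕ Jacob–O'Leary–Atchadé coupled estimator — named only — for a NORMALISED weight
with a mode, `w ≤ W`, whose geometric envelope `rⁿ(c − a)` drove both the summability of the corrections and the convergence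
`(μ₂Kⁿ) f → π f`), using this generation's `…MeetingTimeUnboundedWeights` (`Σ_n P(X_n ≠ X′_n) < ∞` from every start that integrates the
weight) and GEN-39's observable diagnostic lemma `crnLag_integral_abs_diff_le_offDiagonal` (`E|f(X′_n) − f(Y_n)| ≤ (c − a)P(X_n ≠ X′_n)`,
weight-free).  Setting: `K = indepMH q w`, `0 < w` measurable, `π = w·q` a probability law, NO BOUND ON `w`; CRN pair kernel `K̂`; a lag-one
initial coupling `μ̂₀` (`μ̂₀∘fst⁻¹ = (μ̂₀∘snd⁻¹)K`); `a ≤ f ≤ c` measurable; `u_N = (μ̂₀∘snd⁻¹)K^N f = E f(Y_N)`.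

* §1 **`integral_iterate_bind_fst_sub_snd_abs_le_offDiagonal`** — the coupling inequality for a bounded observable at time `n`, every
  coupling: `|((μ̂₀∘fst⁻¹)Kⁿ) f − ((μ̂₀∘snd⁻¹)Kⁿ) f| ≤ (c − a)(μ̂₀K̂ⁿ)(Δᶜ)`; **`lintegral_offDiagonal_prod_le`** [bookkeeping] —
  for a product start `μ₁ ⊗ μ₂`: `∫_{Δᶜ} max(1, w(p.1), w(p.2)) ≤ 1 + ∫ w dμ₁ + ∫ w dμ₂`.
* §2 **`tendsto_integral_iterate_bind_indepMH_unboundedWeights`** — THE PRODUCTION RUN CONVERGES IN MEAN FOR EVERY BOUNDED OBSERVABLE, WITHOUT A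
  WEIGHT BOUND: `(μ₂K^N) f → π f` whenever `∫ w dμ₂ < ∞` and `∫ w dπ = ∫ w² dq < ∞` (witness: a stationary run beside the production run).
* §3 **`crnLag_summable_integral_abs_diff_unboundedWeights`** — `Σ_n E|f(X′_{k+n}) − f(Y_{k+n})| < ∞` whenever both starting laws integrate `w`;
  **`crnLag_hasSum_integral_diff_unboundedWeights`** — `Σ_n E[f(X′_{k+n}) − f(Y_{k+n})] = π f − E f(Y_k)`;
  **`crnLag_integral_tsum_diff_eq_unboundedWeights`**, **`crnLag_unbiased_unboundedWeights`** — `E f(Y_k) + E[Σ_n D_{k+n}] = π f` EXACTLY, every `k`;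
  **`crnLag_unbiased_dirac_unboundedWeights`** — from a single configuration `x` (`μ̂₀ = (δ_xK) ⊗ δ_x`) the only hypothesis left is
  `∫ w dπ = ∫ w² dq < ∞` (used for the stationary witness that identifies the limit of the production run): THE EXACTLY UNBIASED COUPLED
  ESTIMATOR OF GEN-36 NEEDS NO UNIFORM ERGODICITY — a second moment of the importance weight under the model suffices, at every start.
Reading (gauge files): for the flow-driven exact gauge sampler with an unbounded importance weight of finite model-second-moment, the
coupled two-run estimator started from any configuration is exactly unbiased for every bounded observable.
NOT CLAIMED: the variance (GEN-36–39's second-moment files use `W`); a rate; weights with `∫ w² dq = ∞`.  No `sorry`,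
no new definitions, nothing cited as a fact.
-/

noncomputable section

namespace Summit.Ventures.LatticeQCDFlow.Exactness

open MeasureTheory ProbabilityTheory Function Finset Filter Set
open scoped _root_.ENNReal unitInterval Topology
open Summit.Ventures.LatticeQCDFlow.Scoring

variable {Ω : Type*} [MeasurableSpace Ω] {q : Measure Ω} [IsProbabilityMeasure q] {w : Ω → ℝ}

/-! ## §1 The coupling inequality for a bounded observable; product starts -/

/-- **THE COUPLING INEQUALITY FOR A BOUNDED OBSERVABLE AT TIME `n`**: every coupling `μ̂₀`, `a ≤ f ≤ c` measurable:
`|((μ̂₀∘fst⁻¹)Kⁿ) f − ((μ̂₀∘snd⁻¹)Kⁿ) f| ≤ (c − a)·(μ̂₀K̂ⁿ)(Δᶜ)`. [ours] -/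
theorem integral_iterate_bind_fst_sub_snd_abs_le_offDiagonal [MeasurableEq Ω] (hw : Measurable w) (hw0 : ∀ y, 0 < w y)
    (Khat : Kernel (Ω × Ω) (Ω × Ω)) [IsMarkovKernel Khat]
    (hK : ∀ z : Ω × Ω, Khat z = (q.prod (volume : Measure unitInterval)).map (fun p : Ω × unitInterval =>
      ((if (p.2 : ℝ) * w z.1 ≤ w p.1 then p.1 else z.1), (if (p.2 : ℝ) * w z.2 ≤ w p.1 then p.1 else z.2))))
    (μ₀ : Measure (Ω × Ω)) [IsProbabilityMeasure μ₀] {f : Ω → ℝ} (hf : Measurable f) {a c : ℝ} (ha : ∀ x, a ≤ f x)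
    (hc : ∀ x, f x ≤ c) (n : ℕ) :
    |∫ y, f y ∂((fun m : Measure Ω => m.bind (indepMH q w))^[n] (μ₀.map Prod.fst)) -
        ∫ y, f y ∂((fun m : Measure Ω => m.bind (indepMH q w))^[n] (μ₀.map Prod.snd))| ≤
      (c - a) * ((fun m : Measure (Ω × Ω) => m.bind Khat)^[n] μ₀).real (Set.diagonal Ω)ᶜ := by
  haveI := isProbabilityMeasure_iterate_bind (κ := Khat) μ₀ n
  set ρ := (fun m : Measure (Ω × Ω) => m.bind Khat)^[n] μ₀ with hρ
  have hD : MeasurableSet (Set.diagonal Ω) := measurableSet_diagonal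
  have hC : ∀ x, |f x| ≤ max |a| |c| := fun x => abs_le_max_abs_abs (ha x) (hc x)
  rw [← iterate_bind_crnPair_map_fst hw hw0 Khat hK n μ₀, ← iterate_bind_crnPair_map_snd hw hw0 Khat hK n μ₀,
    integral_map measurable_fst.aemeasurable hf.aestronglyMeasurable, integral_map measurable_snd.aemeasurable hf.aestronglyMeasurable]
  have h1 : Integrable (fun p : Ω × Ω => f p.1) ρ := integrable_of_bounded ρ (hf.comp measurable_fst) (fun p => hC _)
  have h2 : Integrable (fun p : Ω × Ω => f p.2) ρ := integrable_of_bounded ρ (hf.comp measurable_snd) (fun p => hC _)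
  rw [← integral_sub h1 h2]
  have hpt : ∀ p : Ω × Ω, |f p.1 - f p.2| ≤ (c - a) * (Set.diagonal Ω)ᶜ.indicator (1 : Ω × Ω → ℝ) p := fun p => by
    by_cases hp : p ∈ (Set.diagonal Ω)ᶜ
    · rw [Set.indicator_of_mem hp, Pi.one_apply, mul_one]
      exact abs_sub_le_iff.2 ⟨by linarith [hc p.1, ha p.2], by linarith [hc p.2, ha p.1]⟩
    · rw [Set.indicator_of_notMem hp, mul_zero]
      simp only [Set.mem_compl_iff, not_not, Set.mem_diagonal_iff] at hp
      rw [hp, sub_self, abs_zero]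
  calc |∫ p, (f p.1 - f p.2) ∂ρ| ≤ ∫ p, |f p.1 - f p.2| ∂ρ := abs_integral_le_integral_abs
    _ ≤ ∫ p, (c - a) * (Set.diagonal Ω)ᶜ.indicator (1 : Ω × Ω → ℝ) p ∂ρ :=
        integral_mono_of_nonneg (ae_of_all _ fun p => abs_nonneg _)
          ((integrable_of_bounded ρ ((measurable_one.indicator hD.compl)) (fun p => abs_indicator_offDiagonal_le_one p)).const_mul _)
          (ae_of_all _ hpt)
    _ = (c - a) * ρ.real (Set.diagonal Ω)ᶜ := by rw [integral_const_mul, integral_indicator_one hD.compl]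

omit [IsProbabilityMeasure q] in
/-- **Product starts**: `∫_{Δᶜ} max(1, w(p.1), w(p.2)) d(μ₁ ⊗ μ₂) ≤ 1 + ∫ w dμ₁ + ∫ w dμ₂` for probability laws `μ₁`, `μ₂`. [ours, bookkeeping] -/
theorem lintegral_offDiagonal_prod_le (hw : Measurable w) (hw0 : ∀ y, 0 < w y) (μ₁ μ₂ : Measure Ω) [IsProbabilityMeasure μ₁]
    [IsProbabilityMeasure μ₂] :
    ∫⁻ p in (Set.diagonal Ω)ᶜ, ENNReal.ofReal (max 1 (max (w p.1) (w p.2))) ∂(μ₁.prod μ₂) ≤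
      1 + ∫⁻ y, ENNReal.ofReal (w y) ∂μ₁ + ∫⁻ y, ENNReal.ofReal (w y) ∂μ₂ := by
  refine (lintegral_max_one_le hw hw0 (μ₁.prod μ₂)).trans (le_of_eq ?_)
  have h1 : ∫⁻ p, ENNReal.ofReal (w p.1) ∂(μ₁.prod μ₂) = ∫⁻ y, ENNReal.ofReal (w y) ∂μ₁ := by
    rw [← lintegral_map hw.ennreal_ofReal measurable_fst, Measure.map_fst_prod, measure_univ, one_smul]
  have h2 : ∫⁻ p, ENNReal.ofReal (w p.2) ∂(μ₁.prod μ₂) = ∫⁻ y, ENNReal.ofReal (w y) ∂μ₂ := by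
    rw [← lintegral_map hw.ennreal_ofReal measurable_snd, Measure.map_snd_prod, measure_univ, one_smul]
  rw [h1, h2, measure_univ]

/-! ## §2 The production run converges in mean, without a weight bound -/

/-- **`(μ₂K^N) f → π f` WITHOUT A WEIGHT BOUND** (standard Borel `Ω`, every proposal law): for a probability start `μ₂` with `∫ w dμ₂ < ∞`,
a target with `∫ w dπ < ∞` (i.e. `∫ w² dq < ∞`) and a bounded measurable `f`. [ours] -/
theorem tendsto_integral_iterate_bind_indepMH_unboundedWeights [StandardBorelSpace Ω] [Nonempty Ω] [MeasurableSingletonClass Ω]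
    [MeasurableEq Ω] (hw : Measurable w) (hw0 : ∀ y, 0 < w y)
    [IsProbabilityMeasure (q.withDensity fun y => ENNReal.ofReal (w y))]
    (hπw : ∫⁻ y, ENNReal.ofReal (w y) ∂(q.withDensity fun y => ENNReal.ofReal (w y)) ≠ ∞)
    (μ₂ : Measure Ω) [IsProbabilityMeasure μ₂] (hμ₂w : ∫⁻ y, ENNReal.ofReal (w y) ∂μ₂ ≠ ∞)
    {f : Ω → ℝ} (hf : Measurable f) {a c : ℝ} (ha : ∀ x, a ≤ f x) (hc : ∀ x, f x ≤ c) :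
    Tendsto (fun N => ∫ y, f y ∂((fun m : Measure Ω => m.bind (indepMH q w))^[N] μ₂)) atTop
      (𝓝 (∫ y, f y ∂(q.withDensity fun y => ENNReal.ofReal (w y)))) := by
  haveI : Fact (Measurable w) := ⟨hw⟩
  obtain ⟨Khat, hMarkov, hK⟩ := exists_crnPairKernel (q := q) hw
  haveI := hMarkov
  set π : Measure Ω := q.withDensity fun y => ENNReal.ofReal (w y) with hπ
  -- the witness coupling: a stationary run beside the production run
  set μ₀ : Measure (Ω × Ω) := π.prod μ₂ with hμ₀
  haveI : IsProbabilityMeasure μ₀ := by rw [hμ₀]; infer_instance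
  have hfst : μ₀.map Prod.fst = π := by rw [hμ₀, Measure.map_fst_prod, measure_univ, one_smul]
  have hsnd : μ₀.map Prod.snd = μ₂ := by rw [hμ₀, Measure.map_snd_prod, measure_univ, one_smul]
  have hπfix : ∀ N, (fun m : Measure Ω => m.bind (indepMH q w))^[N] π = π := fun N => by
    have h : (fun m : Measure Ω => m.bind (indepMH q w)) π = π := indepMH_invariant hw hw0
    exact Function.iterate_fixed h N
  -- the disagreement probability of the witness coupling tends to zero (this generation's unbounded-weight merging)
  have hfin : ∫⁻ p in (Set.diagonal Ω)ᶜ, ENNReal.ofReal (max 1 (max (w p.1) (w p.2))) ∂μ₀ ≠ ∞ :=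
    ne_top_of_le_ne_top (by simpa using ⟨hπw, hμ₂w⟩ : 1 + ∫⁻ y, ENNReal.ofReal (w y) ∂π + ∫⁻ y, ENNReal.ofReal (w y) ∂μ₂ ≠ ∞)
      (lintegral_offDiagonal_prod_le hw hw0 π μ₂)
  have htend := tendsto_offDiagonal_of_lintegral_ne_top hw hw0 Khat hK μ₀ hfin
  have htendR : Tendsto (fun N => (c - a) * ((fun m : Measure (Ω × Ω) => m.bind Khat)^[N] μ₀).real (Set.diagonal Ω)ᶜ)
      atTop (𝓝 0) := by
    have h0 : Tendsto (fun N => ((fun m : Measure (Ω × Ω) => m.bind Khat)^[N] μ₀).real (Set.diagonal Ω)ᶜ) atTop (𝓝 0) := by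
      have h' := (ENNReal.tendsto_toReal ENNReal.zero_ne_top).comp htend
      simpa [measureReal_def, Function.comp_def] using h'
    simpa using h0.const_mul (c - a)
  refine tendsto_iff_norm_sub_tendsto_zero.2 (squeeze_zero (fun N => norm_nonneg _) (fun N => ?_) htendR)
  rw [Real.norm_eq_abs, abs_sub_comm]
  have h := integral_iterate_bind_fst_sub_snd_abs_le_offDiagonal hw hw0 Khat hK μ₀ hf ha hc N
  rwa [hfst, hsnd, hπfix N] at h

/-! ## §3 Exact unbiasedness without a weight bound -/

/-- **THE CORRECTIONS ARE ABSOLUTELY SUMMABLE IN MEAN WITHOUT A WEIGHT BOUND**: for every initial coupling whose two marginals integrate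
the weight, `Σ_n E|f(X′_{k+n}) − f(Y_{k+n})|` converges. [ours] -/
theorem crnLag_summable_integral_abs_diff_unboundedWeights [StandardBorelSpace Ω] [Nonempty Ω] [MeasurableSingletonClass Ω]
    [MeasurableEq Ω] (hw : Measurable w) (hw0 : ∀ y, 0 < w y)
    (Khat : Kernel (Ω × Ω) (Ω × Ω)) [IsMarkovKernel Khat]
    (hK : ∀ z : Ω × Ω, Khat z = (q.prod (volume : Measure unitInterval)).map (fun p : Ω × unitInterval =>
      ((if (p.2 : ℝ) * w z.1 ≤ w p.1 then p.1 else z.1), (if (p.2 : ℝ) * w z.2 ≤ w p.1 then p.1 else z.2))))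
    (μ₀ : Measure (Ω × Ω)) [IsProbabilityMeasure μ₀]
    (hfin : ∫⁻ p in (Set.diagonal Ω)ᶜ, ENNReal.ofReal (max 1 (max (w p.1) (w p.2))) ∂μ₀ ≠ ∞)
    {f : Ω → ℝ} (hf : Measurable f) {a c : ℝ} (ha : ∀ x, a ≤ f x) (hc : ∀ x, f x ≤ c) (k : ℕ) :
    Summable (fun n : ℕ => ∫ z, |f ((z (k + n)).1) - f ((z (k + n)).2)|
      ∂(Kernel.trajMeasure (X := fun _ : ℕ => Ω × Ω) μ₀
        (fun n : ℕ => Khat.comap (fun h : (i : ↥(Finset.Iic n)) → Ω × Ω => h ⟨n, Finset.mem_Iic.2 le_rfl⟩)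
          (measurable_pi_apply _)))) := by
  set d : ℕ → ℝ≥0∞ := fun n => ((fun m : Measure (Ω × Ω) => m.bind Khat)^[n] μ₀) (Set.diagonal Ω)ᶜ with hd
  have hc0 : ∫⁻ y, ENNReal.ofReal (min 1 (w y)) ∂q ≠ 0 := by
    intro h0
    have hae : (fun y => ENNReal.ofReal (min 1 (w y))) =ᵐ[q] 0 :=
      (lintegral_eq_zero_iff (measurable_const.min hw).ennreal_ofReal).1 h0
    have hfalse : ∀ᵐ y ∂q, False := hae.mono fun y hy => by
      have hpos : 0 < ENNReal.ofReal (min 1 (w y)) := ENNReal.ofReal_pos.2 (lt_min one_pos (hw0 y))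
      simp only [Pi.zero_apply] at hy
      exact hpos.ne' hy
    rw [ae_iff] at hfalse
    simp at hfalse
  have htsum : ∑' n, d n ≠ ∞ :=
    ne_top_of_le_ne_top (ENNReal.div_ne_top hfin hc0) (tsum_offDiagonal_le_unboundedWeights hw hw0 Khat hK μ₀)
  have hsumR : Summable (fun n : ℕ => (d (k + n)).toReal) :=
    (ENNReal.summable_toReal htsum).comp_injective (add_right_injective k)
  refine Summable.of_nonneg_of_le (fun n => integral_nonneg fun z => abs_nonneg _) (fun n => ?_) (hsumR.mul_left (c - a))
  have h := crnLag_integral_abs_diff_le_offDiagonal Khat μ₀ hf ha hc (k + n)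
  rwa [measureReal_def] at h

/-- **`Σ_n E[f(X′_{k+n}) − f(Y_{k+n})] = π f − E f(Y_k)` WITHOUT A WEIGHT BOUND** (lag-one coupling whose marginals integrate `w`;
`∫ w dπ = ∫ w² dq < ∞`). [ours] -/
theorem crnLag_hasSum_integral_diff_unboundedWeights [StandardBorelSpace Ω] [Nonempty Ω] [MeasurableSingletonClass Ω]
    [MeasurableEq Ω] (hw : Measurable w) (hw0 : ∀ y, 0 < w y)
    [IsProbabilityMeasure (q.withDensity fun y => ENNReal.ofReal (w y))]
    (hπw : ∫⁻ y, ENNReal.ofReal (w y) ∂(q.withDensity fun y => ENNReal.ofReal (w y)) ≠ ∞)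
    (Khat : Kernel (Ω × Ω) (Ω × Ω)) [IsMarkovKernel Khat]
    (hK : ∀ z : Ω × Ω, Khat z = (q.prod (volume : Measure unitInterval)).map (fun p : Ω × unitInterval =>
      ((if (p.2 : ℝ) * w z.1 ≤ w p.1 then p.1 else z.1), (if (p.2 : ℝ) * w z.2 ≤ w p.1 then p.1 else z.2))))
    (μ₀ : Measure (Ω × Ω)) [IsProbabilityMeasure μ₀]
    (hlag : μ₀.map Prod.fst = (μ₀.map Prod.snd).bind (indepMH q w))
    (hμ₁w : ∫⁻ p, ENNReal.ofReal (w p.1) ∂μ₀ ≠ ∞) (hμ₂w : ∫⁻ p, ENNReal.ofReal (w p.2) ∂μ₀ ≠ ∞)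
    {f : Ω → ℝ} (hf : Measurable f) {a c : ℝ} (ha : ∀ x, a ≤ f x) (hc : ∀ x, f x ≤ c) (k : ℕ) :
    HasSum (fun n : ℕ => ∫ z, (f ((z (k + n)).1) - f ((z (k + n)).2))
        ∂(Kernel.trajMeasure (X := fun _ : ℕ => Ω × Ω) μ₀
          (fun n : ℕ => Khat.comap (fun h : (i : ↥(Finset.Iic n)) → Ω × Ω => h ⟨n, Finset.mem_Iic.2 le_rfl⟩)
            (measurable_pi_apply _))))
      (∫ x, f x ∂(q.withDensity fun y => ENNReal.ofReal (w y)) -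
        ∫ z, f ((z k).2) ∂(Kernel.trajMeasure (X := fun _ : ℕ => Ω × Ω) μ₀
          (fun n : ℕ => Khat.comap (fun h : (i : ↥(Finset.Iic n)) → Ω × Ω => h ⟨n, Finset.mem_Iic.2 le_rfl⟩)
            (measurable_pi_apply _)))) := by
  haveI : Fact (Measurable w) := ⟨hw⟩
  haveI : IsProbabilityMeasure (μ₀.map Prod.snd) := Measure.isProbabilityMeasure_map measurable_snd.aemeasurable
  set π : Measure Ω := q.withDensity fun y => ENNReal.ofReal (w y) with hπ
  set μ₂ : Measure Ω := μ₀.map Prod.snd with hμ₂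
  set u : ℕ → ℝ := fun N => ∫ y, f y ∂((fun m : Measure Ω => m.bind (indepMH q w))^[N] μ₂) with hu
  have hC : ∀ x, |f x| ≤ max |a| |c| := fun x => abs_le_max_abs_abs (ha x) (hc x)
  have hterm : ∀ n, ∫ z, (f ((z (k + n)).1) - f ((z (k + n)).2))
      ∂(Kernel.trajMeasure (X := fun _ : ℕ => Ω × Ω) μ₀
        (fun n : ℕ => Khat.comap (fun h : (i : ↥(Finset.Iic n)) → Ω × Ω => h ⟨n, Finset.mem_Iic.2 le_rfl⟩)
          (measurable_pi_apply _))) = u (k + n + 1) - u (k + n) := fun n =>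
    crnLag_integral_diff_eq hw0 Khat hK μ₀ hlag hf hC (k + n)
  have hYk : ∫ z, f ((z k).2) ∂(Kernel.trajMeasure (X := fun _ : ℕ => Ω × Ω) μ₀
        (fun n : ℕ => Khat.comap (fun h : (i : ↥(Finset.Iic n)) → Ω × Ω => h ⟨n, Finset.mem_Iic.2 le_rfl⟩)
          (measurable_pi_apply _))) = u k := crnLag_integral_snd_eq hw0 Khat hK μ₀ hf hC k
  simp_rw [hterm]
  rw [hYk]
  -- `u N → π f` by §2 (the start `μ₂` integrates the weight)
  have hμ₂w' : ∫⁻ y, ENNReal.ofReal (w y) ∂μ₂ ≠ ∞ := by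
    rwa [hμ₂, lintegral_map hw.ennreal_ofReal measurable_snd]
  have hlim : Tendsto u atTop (𝓝 (∫ x, f x ∂π)) :=
    tendsto_integral_iterate_bind_indepMH_unboundedWeights hw hw0 hπw μ₂ hμ₂w' hf ha hc
  -- summability of the corrections (both marginals integrate the weight)
  have hfin : ∫⁻ p in (Set.diagonal Ω)ᶜ, ENNReal.ofReal (max 1 (max (w p.1) (w p.2))) ∂μ₀ ≠ ∞ :=
    ne_top_of_le_ne_top (by simpa using ⟨hμ₁w, hμ₂w⟩ : μ₀ Set.univ + ∫⁻ p, ENNReal.ofReal (w p.1) ∂μ₀ +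
      ∫⁻ p, ENNReal.ofReal (w p.2) ∂μ₀ ≠ ∞) (lintegral_max_one_le hw hw0 μ₀)
  have hpartial : ∀ N, ∑ n ∈ Finset.range N, (u (k + n + 1) - u (k + n)) = u (k + N) - u k := by
    intro N
    have := Finset.sum_range_sub (fun n => u (k + n)) N
    simpa [Nat.add_assoc] using this
  have hsumm : Summable (fun n : ℕ => u (k + n + 1) - u (k + n)) := by
    refine Summable.of_norm_bounded (g := fun n : ℕ => ∫ z, |f ((z (k + n)).1) - f ((z (k + n)).2)|
      ∂(Kernel.trajMeasure (X := fun _ : ℕ => Ω × Ω) μ₀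
        (fun n : ℕ => Khat.comap (fun h : (i : ↥(Finset.Iic n)) → Ω × Ω => h ⟨n, Finset.mem_Iic.2 le_rfl⟩)
          (measurable_pi_apply _))))
      (crnLag_summable_integral_abs_diff_unboundedWeights hw hw0 Khat hK μ₀ hfin hf ha hc k) (fun n => ?_)
    rw [← hterm n, Real.norm_eq_abs]
    exact abs_integral_le_integral_abs
  have hlim2 : Tendsto (fun N => ∑ n ∈ Finset.range N, (u (k + n + 1) - u (k + n))) atTop
      (𝓝 (∫ x, f x ∂π - u k)) := by
    simp_rw [hpartial]
    have hshift : Tendsto (fun N => u (k + N)) atTop (𝓝 (∫ x, f x ∂π)) :=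
      hlim.comp (tendsto_atTop_atTop_of_monotone (fun _ _ h => Nat.add_le_add_left h k)
        fun N => ⟨N, Nat.le_add_left N k⟩)
    exact hshift.sub_const (u k)
  have heq : ∑' n, (u (k + n + 1) - u (k + n)) = ∫ x, f x ∂π - u k :=
    tendsto_nhds_unique hsumm.hasSum.tendsto_sum_nat hlim2
  rw [← heq]
  exact hsumm.hasSum

/-- **`E[Σ_n D_{k+n}] = π f − E f(Y_k)` WITHOUT A WEIGHT BOUND** (the expectation of the summed corrections is the sum of their
expectations: dominated convergence with the summable envelope of §3). [ours] -/
theorem crnLag_integral_tsum_diff_eq_unboundedWeights [StandardBorelSpace Ω] [Nonempty Ω] [MeasurableSingletonClass Ω]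
    [MeasurableEq Ω] (hw : Measurable w) (hw0 : ∀ y, 0 < w y)
    [IsProbabilityMeasure (q.withDensity fun y => ENNReal.ofReal (w y))]
    (hπw : ∫⁻ y, ENNReal.ofReal (w y) ∂(q.withDensity fun y => ENNReal.ofReal (w y)) ≠ ∞)
    (Khat : Kernel (Ω × Ω) (Ω × Ω)) [IsMarkovKernel Khat]
    (hK : ∀ z : Ω × Ω, Khat z = (q.prod (volume : Measure unitInterval)).map (fun p : Ω × unitInterval =>
      ((if (p.2 : ℝ) * w z.1 ≤ w p.1 then p.1 else z.1), (if (p.2 : ℝ) * w z.2 ≤ w p.1 then p.1 else z.2))))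
    (μ₀ : Measure (Ω × Ω)) [IsProbabilityMeasure μ₀]
    (hlag : μ₀.map Prod.fst = (μ₀.map Prod.snd).bind (indepMH q w))
    (hμ₁w : ∫⁻ p, ENNReal.ofReal (w p.1) ∂μ₀ ≠ ∞) (hμ₂w : ∫⁻ p, ENNReal.ofReal (w p.2) ∂μ₀ ≠ ∞)
    {f : Ω → ℝ} (hf : Measurable f) {a c : ℝ} (ha : ∀ x, a ≤ f x) (hc : ∀ x, f x ≤ c) (k : ℕ) :
    ∫ z, (∑' n : ℕ, (f ((z (k + n)).1) - f ((z (k + n)).2)))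
        ∂(Kernel.trajMeasure (X := fun _ : ℕ => Ω × Ω) μ₀
          (fun n : ℕ => Khat.comap (fun h : (i : ↥(Finset.Iic n)) → Ω × Ω => h ⟨n, Finset.mem_Iic.2 le_rfl⟩)
            (measurable_pi_apply _))) =
      ∫ x, f x ∂(q.withDensity fun y => ENNReal.ofReal (w y)) -
        ∫ z, f ((z k).2) ∂(Kernel.trajMeasure (X := fun _ : ℕ => Ω × Ω) μ₀
          (fun n : ℕ => Khat.comap (fun h : (i : ↥(Finset.Iic n)) → Ω × Ω => h ⟨n, Finset.mem_Iic.2 le_rfl⟩)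
            (measurable_pi_apply _))) := by
  set P := Kernel.trajMeasure (X := fun _ : ℕ => Ω × Ω) μ₀
        (fun n : ℕ => Khat.comap (fun h : (i : ↥(Finset.Iic n)) → Ω × Ω => h ⟨n, Finset.mem_Iic.2 le_rfl⟩)
          (measurable_pi_apply _)) with hP
  have hC : ∀ x, |f x| ≤ max |a| |c| := fun x => abs_le_max_abs_abs (ha x) (hc x)
  have hDm : ∀ n, Measurable (fun z : ℕ → Ω × Ω => f ((z (k + n)).1) - f ((z (k + n)).2)) := fun n =>
    (hf.comp (measurable_fst.comp (measurable_pi_apply _))).sub (hf.comp (measurable_snd.comp (measurable_pi_apply _)))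
  have hDb : ∀ n (z : ℕ → Ω × Ω), |f ((z (k + n)).1) - f ((z (k + n)).2)| ≤ c - a := by
    intro n z
    have h1 := ha ((z (k + n)).1); have h2 := hc ((z (k + n)).1)
    have h3 := ha ((z (k + n)).2); have h4 := hc ((z (k + n)).2)
    exact abs_le.2 ⟨by linarith, by linarith⟩
  have hDi : ∀ n, Integrable (fun z : ℕ → Ω × Ω => f ((z (k + n)).1) - f ((z (k + n)).2)) P := fun n =>
    integrable_of_bounded P (hDm n) (hDb n)
  have hfin : ∫⁻ p in (Set.diagonal Ω)ᶜ, ENNReal.ofReal (max 1 (max (w p.1) (w p.2))) ∂μ₀ ≠ ∞ :=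
    ne_top_of_le_ne_top (by simpa using ⟨hμ₁w, hμ₂w⟩ : μ₀ Set.univ + ∫⁻ p, ENNReal.ofReal (w p.1) ∂μ₀ +
      ∫⁻ p, ENNReal.ofReal (w p.2) ∂μ₀ ≠ ∞) (lintegral_max_one_le hw hw0 μ₀)
  have hsum : Summable (fun n => ∫ z, ‖f ((z (k + n)).1) - f ((z (k + n)).2)‖ ∂P) := by
    simp_rw [Real.norm_eq_abs]
    exact crnLag_summable_integral_abs_diff_unboundedWeights hw hw0 Khat hK μ₀ hfin hf ha hc k
  rw [← integral_tsum_of_summable_integral_norm hDi hsum]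
  exact (crnLag_hasSum_integral_diff_unboundedWeights hw hw0 hπw Khat hK μ₀ hlag hμ₁w hμ₂w hf ha hc k).tsum_eq

/-- **THE COUPLED ESTIMATOR IS EXACTLY UNBIASED WITHOUT A WEIGHT BOUND**: `E f(Y_k) + E[Σ_{n≥0}(f(X′_{k+n}) − f(Y_{k+n}))] = π f`
for every lag-one coupling whose marginals integrate the weight and every target with `∫ w dπ = ∫ w² dq < ∞`. [ours] -/
theorem crnLag_unbiased_unboundedWeights [StandardBorelSpace Ω] [Nonempty Ω] [MeasurableSingletonClass Ω]
    [MeasurableEq Ω] (hw : Measurable w) (hw0 : ∀ y, 0 < w y)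
    [IsProbabilityMeasure (q.withDensity fun y => ENNReal.ofReal (w y))]
    (hπw : ∫⁻ y, ENNReal.ofReal (w y) ∂(q.withDensity fun y => ENNReal.ofReal (w y)) ≠ ∞)
    (Khat : Kernel (Ω × Ω) (Ω × Ω)) [IsMarkovKernel Khat]
    (hK : ∀ z : Ω × Ω, Khat z = (q.prod (volume : Measure unitInterval)).map (fun p : Ω × unitInterval =>
      ((if (p.2 : ℝ) * w z.1 ≤ w p.1 then p.1 else z.1), (if (p.2 : ℝ) * w z.2 ≤ w p.1 then p.1 else z.2))))
    (μ₀ : Measure (Ω × Ω)) [IsProbabilityMeasure μ₀]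
    (hlag : μ₀.map Prod.fst = (μ₀.map Prod.snd).bind (indepMH q w))
    (hμ₁w : ∫⁻ p, ENNReal.ofReal (w p.1) ∂μ₀ ≠ ∞) (hμ₂w : ∫⁻ p, ENNReal.ofReal (w p.2) ∂μ₀ ≠ ∞)
    {f : Ω → ℝ} (hf : Measurable f) {a c : ℝ} (ha : ∀ x, a ≤ f x) (hc : ∀ x, f x ≤ c) (k : ℕ) :
    ∫ z, f ((z k).2) ∂(Kernel.trajMeasure (X := fun _ : ℕ => Ω × Ω) μ₀
          (fun n : ℕ => Khat.comap (fun h : (i : ↥(Finset.Iic n)) → Ω × Ω => h ⟨n, Finset.mem_Iic.2 le_rfl⟩)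
            (measurable_pi_apply _))) +
      ∫ z, (∑' n : ℕ, (f ((z (k + n)).1) - f ((z (k + n)).2)))
        ∂(Kernel.trajMeasure (X := fun _ : ℕ => Ω × Ω) μ₀
          (fun n : ℕ => Khat.comap (fun h : (i : ↥(Finset.Iic n)) → Ω × Ω => h ⟨n, Finset.mem_Iic.2 le_rfl⟩)
            (measurable_pi_apply _))) =
      ∫ x, f x ∂(q.withDensity fun y => ENNReal.ofReal (w y)) := by
  rw [crnLag_integral_tsum_diff_eq_unboundedWeights hw hw0 hπw Khat hK μ₀ hlag hμ₁w hμ₂w hf ha hc k]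
  ring

/-- **FROM A SINGLE CONFIGURATION `x`, WITHOUT A WEIGHT BOUND**: `μ̂₀ = (δ_xK) ⊗ δ_x` (production run at `x`, leading run one independent
update out of `x`); the only hypothesis left is `∫ w dπ = ∫ w² dq < ∞` (for the witness that identifies the limit):
`E f(Y_k) + E[Σ_{n≥0}(f(X′_{k+n}) − f(Y_{k+n}))] = π f` EXACTLY, for every `x`, `k` and bounded measurable `f`. [ours] -/
theorem crnLag_unbiased_dirac_unboundedWeights [StandardBorelSpace Ω] [Nonempty Ω] [MeasurableSingletonClass Ω]
    [MeasurableEq Ω] (hw : Measurable w) (hw0 : ∀ y, 0 < w y)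
    [IsProbabilityMeasure (q.withDensity fun y => ENNReal.ofReal (w y))]
    (hπw : ∫⁻ y, ENNReal.ofReal (w y) ∂(q.withDensity fun y => ENNReal.ofReal (w y)) ≠ ∞)
    (Khat : Kernel (Ω × Ω) (Ω × Ω)) [IsMarkovKernel Khat]
    (hK : ∀ z : Ω × Ω, Khat z = (q.prod (volume : Measure unitInterval)).map (fun p : Ω × unitInterval =>
      ((if (p.2 : ℝ) * w z.1 ≤ w p.1 then p.1 else z.1), (if (p.2 : ℝ) * w z.2 ≤ w p.1 then p.1 else z.2))))
    (x : Ω) [IsProbabilityMeasure (((Measure.dirac x).bind (indepMH q w)).prod (Measure.dirac x))]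
    {f : Ω → ℝ} (hf : Measurable f) {a c : ℝ} (ha : ∀ x, a ≤ f x) (hc : ∀ x, f x ≤ c) (k : ℕ) :
    ∫ z, f ((z k).2) ∂(Kernel.trajMeasure (X := fun _ : ℕ => Ω × Ω)
          (((Measure.dirac x).bind (indepMH q w)).prod (Measure.dirac x))
          (fun n : ℕ => Khat.comap (fun h : (i : ↥(Finset.Iic n)) → Ω × Ω => h ⟨n, Finset.mem_Iic.2 le_rfl⟩)
            (measurable_pi_apply _))) +
      ∫ z, (∑' n : ℕ, (f ((z (k + n)).1) - f ((z (k + n)).2)))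
        ∂(Kernel.trajMeasure (X := fun _ : ℕ => Ω × Ω)
          (((Measure.dirac x).bind (indepMH q w)).prod (Measure.dirac x))
          (fun n : ℕ => Khat.comap (fun h : (i : ↥(Finset.Iic n)) → Ω × Ω => h ⟨n, Finset.mem_Iic.2 le_rfl⟩)
            (measurable_pi_apply _))) =
      ∫ x, f x ∂(q.withDensity fun y => ENNReal.ofReal (w y)) := by
  haveI : Fact (Measurable w) := ⟨hw⟩
  have hbind : (Measure.dirac x).bind (indepMH q w) = indepMH q w x := Measure.dirac_bind (Kernel.measurable _) x
  haveI h1 : IsProbabilityMeasure ((Measure.dirac x).bind (indepMH q w)) := by rw [hbind]; infer_instance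
  set μ₀ := ((Measure.dirac x).bind (indepMH q w)).prod (Measure.dirac x) with hμ₀
  have hlag : μ₀.map Prod.fst = (μ₀.map Prod.snd).bind (indepMH q w) := by
    rw [hμ₀, Measure.map_fst_prod, Measure.map_snd_prod, measure_univ, measure_univ, one_smul, one_smul]
  have hμ₁w : ∫⁻ p, ENNReal.ofReal (w p.1) ∂μ₀ ≠ ∞ := by
    rw [← lintegral_map hw.ennreal_ofReal measurable_fst, Measure.map_fst_prod, measure_univ, one_smul, hbind]
    exact ne_top_of_le_ne_top (ENNReal.add_ne_top.2 ⟨ENNReal.one_ne_top, ENNReal.ofReal_ne_top⟩) (lintegral_weight_indepMH_le hw x)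
  have hμ₂w : ∫⁻ p, ENNReal.ofReal (w p.2) ∂μ₀ ≠ ∞ := by
    rw [← lintegral_map hw.ennreal_ofReal measurable_snd, Measure.map_snd_prod, measure_univ, one_smul,
      lintegral_dirac' _ hw.ennreal_ofReal]
    exact ENNReal.ofReal_ne_top
  exact crnLag_unbiased_unboundedWeights hw hw0 hπw Khat hK μ₀ hlag hμ₁w hμ₂w hf ha hc k

end Summit.Ventures.LatticeQCDFlow.Exactness

end
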